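import Summits.BirchSwinnertonDyer.BirchSwinnertonDyer.Theorems.ManinLocalTwoThreeManinConstantFourteen
import Summits.BirchSwinnertonDyer.BirchSwinnertonDyer.Theorems.ManinLocalTwoThreeManinConstantFifteen
import Summits.BirchSwinnertonDyer.BirchSwinnertonDyer.Theorems.ManinLocalTwoThreeExistsMinimalOptimalDatumUnconditional
import Summits.BirchSwinnertonDyer.Rank1Residual.Additive.IntModelConductorCertificate
import Literature.NumberTheory.Automorphic.ShimuraCurveRibetTakahashiOptimalModularityProofs
import Summits.BirchSwinnertonDyer.BirchSwinnertonDyer.Theorems.EisensteinDepletionAtTwoStarOptBSigmaNodeFifteenAll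
import HarnessLib

/-!
# Levels 14 and 15: `N(14a1) = 14`, `N(15a1) = 15` in the kernel; the `X₀(14)`- and `X₀(15)`-domains are inhabited under
# the cruxes' own modularity binder, and every datum there has `|c| = 1` (fact-free)

Cell bsd-f2-manin, route `ManinLocalTwoThree` (cruxes C2 `ManinOddAtFour` stmt-22967 / C3 `ManinPrimeToThreeAtNine` stmt-22968),
prover seat p3 gen 25; the level-`14`/`15` twin of `…NonVacuityTwenty`, completing this seat's root packages
`…ManinConstantFourteen` / `…ManinConstantFifteen` (`|c| = 1` on every lattice-optimal `X₀(14)`- resp. `X₀(15)`-datum, fact-free).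

* §1 **`N([1, 0, 1, 4, −6]) = N(14a1) = 14`** by the rank-2 observatory's kernel certificates
  (`IntModelCond.conductorNorm_mk_eq_of_certs_of_eq`, NO named fact): `14a1` is multiplicative at `2` (`2 ∣ Δ = −2⁶7³`, `2 ∤ c₄ = −215`),
  good at `3`, split multiplicative at `7` (root `t = 2` of the node-tangent quadratic); `N(15a1) = 15` is the tree's
  `DepletionAtTwo.SigmaNode.conductorNorm_15a1` (reused).
* §2 GIVEN THE CRUXES' OWN BINDER `exists_isNewformOf` (modularity, Diamond–Shurman Thm. 8.8.3): `14a1` (`15a1`) has a newform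
  in `S₂(Γ₀(14))` (`S₂(Γ₀(15))`); it is `f₁₄ = η₁η₂η₇η₁₄` (`f₁₅ = η₁η₃η₅η₁₅`) by `LevelFourteen.eq_cuspFormEta14_of_isNewform0`
  (`LevelFifteen.…`), so `aₙ(f₁₄) = aₙ(14a1)`, `aₙ(f₁₅) = aₙ(15a1)` for all `n`; a lattice-optimal `X₀(14)`- (`X₀(15)`-) datum on a
  globally minimal curve of the class `14a` (`15a`) exists (Literature's datum package + the unconditional EXO
  `existsMinimalOptimalDatum_full`) — the `∀`-domains of `LevelManinOne 14 / 15` are inhabited relative to modularity — and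
  (fact-free) EVERY such datum has `|c| = 1`.

HONEST FRAMING: §1 unconditional (kernel certificates, standard axioms); §2 CONDITIONAL on `exists_isNewformOf` only.  Nothing
here proves C2, C3, Manin's conjecture or BSD; items 22967/22968 stay OPEN.  No definition, no named fact, no sorry.
[cite: Silverman1994, IV.9.4 and IV.11.1] [cite: SilvermanAEC2009, VII.1 Remark 1.1, VII.5.1] [cite: CremonaAlgorithms1997, Table 1 (14a1, 15a1)]
[cite: DiamondShurman2005, Thm. 8.8.3] [cite: EdixhovenManin1991, Prop. 2]
-/

set_option autoImplicit false
-- lint-debt: the directory name repeats the summit name (sibling precedent `ManinLocalTwoThreeNonVacuityTwenty.lean`)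
set_option linter.dupNamespace false

noncomputable section

open Complex Filter Topology Set Function
open UpperHalfPlane hiding I
open scoped Real Topology Manifold MatrixGroups ModularForm
open ModularForm CongruenceSubgroup WeierstrassCurve
open Summit.BirchSwinnertonDyer.BirchSwinnertonDyer.Rank2Observatory
open Summit.BirchSwinnertonDyer.BirchSwinnertonDyer.Rank2Observatory.RootNumber
open Summit.BirchSwinnertonDyer.BirchSwinnertonDyer.Rank2Observatory.Tate
open Summit.BirchSwinnertonDyer.Rank1Residual.Additive
open Literature.NumberTheory.EllipticCurves Literature.NumberTheory.EllipticCurves.ModularForms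
open Literature.NumberTheory.Automorphic

namespace Summit.BirchSwinnertonDyer.BirchSwinnertonDyer.Theorems.ManinLocalTwoThree.NonVacuityFourteenFifteen

/-! ## §1 Conductors `14` and `15` in the kernel -/

/-- The literal `ℚ`-model `14a1 = [1, 0, 1, 4, −6]` read through integer casts. [folklore] -/
theorem mk_fourteenA1_eq_cast :
    (⟨1, 0, 1, 4, -6⟩ : WeierstrassCurve ℚ) = ⟨((1 : ℤ) : ℚ), ((0 : ℤ) : ℚ), ((1 : ℤ) : ℚ), ((4 : ℤ) : ℚ), ((-6 : ℤ) : ℚ)⟩ := by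
  ext <;> norm_num

/-- **`N(14a1) = N([1, 0, 1, 4, −6]) = 14 = 2·7`**: multiplicative at `2` (`2 ∣ Δ = −2⁶·7³`, `2 ∤ c₄ = −215`), good at `3`,
split multiplicative at `7` (node-tangent root `t = 2`); minimality `v₂(Δ) = 6 < 12`, `7 ∤ c₄`.  NO named fact.
[cite: Silverman1994, IV.11.1] [cite: CremonaAlgorithms1997, Table 1 (14a1)] -/
theorem conductorNorm_fourteenA1 : (⟨1, 0, 1, 4, -6⟩ : WeierstrassCurve ℚ).conductorNorm ℤ = 14 := by
  rw [mk_fourteenA1_eq_cast]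
  exact IntModelCond.conductorNorm_mk_eq_of_certs_of_eq 1 0 1 4 (-6)
    (cm := ⟨6, 0, 0, [⟨7, 2, 3, 1, 2⟩]⟩) (c := ⟨6, 0, 0, 0, 0, 0, [⟨7, 2, 3, 1, 2⟩]⟩)
    (l₂ := ⟨1, 0, 0, 0, 0, 0, 0⟩) (l₃ := ⟨0, 0, 0, 0, 0, 0, 0⟩)
    (by decide +kernel) (by decide +kernel) (by decide +kernel) (by decide +kernel) (by decide +kernel)

-- `N(15a1) = 15` is already in the tree: `DepletionAtTwo.SigmaNode.conductorNorm_15a1` (semistable radical formula); reused below.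

/-! ## §2 The domains of `LevelManinOne 14`, `LevelManinOne 15` are inhabited, GIVEN the binder `exists_isNewformOf` -/

/-- **Modularity at `14a1`, levelled**: under `exists_isNewformOf` the curve `[1, 0, 1, 4, −6]` has a newform in `S₂(Γ₀(14))`
(its conductor IS `14`, §1).  CONDITIONAL on modularity. [cite: DiamondShurman2005, Thm. 8.8.3] -/
theorem exists_isNewformOf_fourteenA1 (hnf : exists_isNewformOf) :
    ∃ f : CuspForm (Gamma0 14) 2, IsNewformOf (⟨1, 0, 1, 4, -6⟩ : WeierstrassCurve ℚ) f := by
  haveI := LevelFourteen.isElliptic_W14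
  have key : ∀ (N : ℕ) [NeZero N], (⟨1, 0, 1, 4, -6⟩ : WeierstrassCurve ℚ).conductorNorm ℤ = N →
      ∃ f : CuspForm (Gamma0 N) 2, IsNewformOf (⟨1, 0, 1, 4, -6⟩ : WeierstrassCurve ℚ) f := by
    intro N _ hN
    subst hN
    exact hnf _
  haveI : NeZero (14 : ℕ) := ⟨by decide⟩
  exact key 14 conductorNorm_fourteenA1

/-- **Modularity at `15a1`, levelled**: under `exists_isNewformOf` the curve `[1, 1, 1, −10, −10]` has a newform in
`S₂(Γ₀(15))`.  CONDITIONAL on modularity. [cite: DiamondShurman2005, Thm. 8.8.3] -/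
theorem exists_isNewformOf_fifteenA1 (hnf : exists_isNewformOf) :
    ∃ f : CuspForm (Gamma0 15) 2, IsNewformOf (⟨1, 1, 1, -10, -10⟩ : WeierstrassCurve ℚ) f := by
  haveI := LevelFifteen.isElliptic_W15
  have key : ∀ (N : ℕ) [NeZero N], (⟨1, 1, 1, -10, -10⟩ : WeierstrassCurve ℚ).conductorNorm ℤ = N →
      ∃ f : CuspForm (Gamma0 N) 2, IsNewformOf (⟨1, 1, 1, -10, -10⟩ : WeierstrassCurve ℚ) f := by
    intro N _ hN
    subst hN
    exact hnf _
  haveI : NeZero (15 : ℕ) := ⟨by decide⟩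
  exact key 15 DepletionAtTwo.SigmaNode.conductorNorm_15a1

/-- Under modularity the newform of `14a1` IS `f₁₄ = η₁η₂η₇η₁₄`: **`aₙ(η₁η₂η₇η₁₄) = aₙ(14a1)` for all `n`** (the only newform of
level `14`).  CONDITIONAL on `exists_isNewformOf`. [cite: CremonaAlgorithms1997, Table 3 (N = 14)] -/
theorem cuspCoeff_cuspFormEta14_eq_lFunction_of_modularity (hnf : exists_isNewformOf) (n : ℕ) :
    cuspCoeff cuspFormEta14 n = ((⟨1, 0, 1, 4, -6⟩ : WeierstrassCurve ℚ).LFunction n : ℂ) := by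
  haveI := LevelFourteen.isElliptic_W14
  obtain ⟨f, hf⟩ := exists_isNewformOf_fourteenA1 hnf
  rw [← LevelFourteen.eq_cuspFormEta14_of_isNewform0 hf.1]
  exact hf.2 n

/-- Under modularity the newform of `15a1` IS `f₁₅ = η₁η₃η₅η₁₅`: **`aₙ(η₁η₃η₅η₁₅) = aₙ(15a1)` for all `n`**.  CONDITIONAL on
`exists_isNewformOf`. [cite: CremonaAlgorithms1997, Table 3 (N = 15)] -/
theorem cuspCoeff_cuspFormEta15_eq_lFunction_of_modularity (hnf : exists_isNewformOf) (n : ℕ) :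
    cuspCoeff cuspFormEta15 n = ((⟨1, 1, 1, -10, -10⟩ : WeierstrassCurve ℚ).LFunction n : ℂ) := by
  haveI := LevelFifteen.isElliptic_W15
  obtain ⟨f, hf⟩ := exists_isNewformOf_fifteenA1 hnf
  rw [← LevelFifteen.eq_cuspFormEta15_of_isNewform0 hf.1]
  exact hf.2 n

/-- **A lattice-optimal `X₀(14)`-datum on a globally minimal curve of the class `14a` exists under modularity** (Literature's datum
package + the unconditional EXO), i.e. the `∀`-domain of `LevelManinOne 14` is inhabited relative to `exists_isNewformOf`.
[cite: EdixhovenManin1991, Prop. 2] [cite: DiamondShurman2005, Thm. 8.8.3] -/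
theorem domain_inhabited_fourteen_of_modularity (hnf : exists_isNewformOf) :
    ∃ (W₀ : WeierstrassCurve ℚ) (_ : W₀.IsElliptic) (_ : W₀.IsGloballyMinimal) (D₀ : ModularParametrizationData W₀ 14),
      (⟨1, 0, 1, 4, -6⟩ : WeierstrassCurve ℚ).IsIsogenous W₀ ∧ (∀ z ∈ D₀.L.lattice, ∃ w ∈ periodLattice D₀.f, z = D₀.c * w) := by
  haveI := LevelFourteen.isElliptic_W14
  haveI : NeZero (14 : ℕ) := ⟨by decide⟩
  obtain ⟨f, hf⟩ := exists_isNewformOf_fourteenA1 hnf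
  obtain ⟨D⟩ := nonempty_modularParametrizationData_of_isNewformOf hf
  obtain ⟨W₀, h₀, hmin, D₀, -, hiso, hopt, -⟩ :=
    ExistsMinimalOptimalDatum.existsMinimalOptimalDatum_full (⟨1, 0, 1, 4, -6⟩ : WeierstrassCurve ℚ) D
  exact ⟨W₀, h₀, hmin, D₀, hiso, hopt⟩

/-- **A lattice-optimal `X₀(15)`-datum on a globally minimal curve of the class `15a` exists under modularity.**
[cite: EdixhovenManin1991, Prop. 2] [cite: DiamondShurman2005, Thm. 8.8.3] -/
theorem domain_inhabited_fifteen_of_modularity (hnf : exists_isNewformOf) :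
    ∃ (W₀ : WeierstrassCurve ℚ) (_ : W₀.IsElliptic) (_ : W₀.IsGloballyMinimal) (D₀ : ModularParametrizationData W₀ 15),
      (⟨1, 1, 1, -10, -10⟩ : WeierstrassCurve ℚ).IsIsogenous W₀ ∧
        (∀ z ∈ D₀.L.lattice, ∃ w ∈ periodLattice D₀.f, z = D₀.c * w) := by
  haveI := LevelFifteen.isElliptic_W15
  haveI : NeZero (15 : ℕ) := ⟨by decide⟩
  obtain ⟨f, hf⟩ := exists_isNewformOf_fifteenA1 hnf
  obtain ⟨D⟩ := nonempty_modularParametrizationData_of_isNewformOf hf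
  obtain ⟨W₀, h₀, hmin, D₀, -, hiso, hopt, -⟩ :=
    ExistsMinimalOptimalDatum.existsMinimalOptimalDatum_full (⟨1, 1, 1, -10, -10⟩ : WeierstrassCurve ℚ) D
  exact ⟨W₀, h₀, hmin, D₀, hiso, hopt⟩

/-- **`LevelManinOne 14` is NON-VACUOUSLY TRUE under modularity alone**: there IS a globally minimal elliptic `W₀/ℚ` with a
lattice-optimal `X₀(14)`-datum (conditional on `exists_isNewformOf`), and EVERY lattice-optimal `X₀(14)`-datum of EVERY globally
minimal elliptic `W/ℚ` has `|c| = 1` (fact-free, `LevelFourteen.abs_maninConstant_eq_one_fourteen`).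
[cite: EdixhovenManin1991, Prop. 2] [cite: AgasheRibetStein2006, §§1–2] -/
theorem levelManinOne_fourteen_nonvacuous_of_modularity (hnf : exists_isNewformOf) :
    (∃ (W₀ : WeierstrassCurve ℚ) (_ : W₀.IsElliptic) (_ : W₀.IsGloballyMinimal) (D₀ : ModularParametrizationData W₀ 14),
        (∀ z ∈ D₀.L.lattice, ∃ w ∈ periodLattice D₀.f, z = D₀.c * w) ∧ |D₀.maninConstant| = 1) ∧
      ∀ (W : WeierstrassCurve ℚ) [W.IsElliptic] [W.IsGloballyMinimal] (D : ModularParametrizationData W 14),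
        (∀ z ∈ D.L.lattice, ∃ w ∈ periodLattice D.f, z = D.c * w) → |D.maninConstant| = 1 := by
  refine ⟨?_, fun W _ _ D hopt ↦ LevelFourteen.abs_maninConstant_eq_one_fourteen W D hopt⟩
  obtain ⟨W₀, h₀, hmin, D₀, -, hopt⟩ := domain_inhabited_fourteen_of_modularity hnf
  haveI := h₀
  haveI := hmin
  exact ⟨W₀, h₀, hmin, D₀, hopt, LevelFourteen.abs_maninConstant_eq_one_fourteen W₀ D₀ hopt⟩

/-- **`LevelManinOne 15` is NON-VACUOUSLY TRUE under modularity alone.** [cite: EdixhovenManin1991, Prop. 2] [cite: AgasheRibetStein2006, §§1–2] -/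
theorem levelManinOne_fifteen_nonvacuous_of_modularity (hnf : exists_isNewformOf) :
    (∃ (W₀ : WeierstrassCurve ℚ) (_ : W₀.IsElliptic) (_ : W₀.IsGloballyMinimal) (D₀ : ModularParametrizationData W₀ 15),
        (∀ z ∈ D₀.L.lattice, ∃ w ∈ periodLattice D₀.f, z = D₀.c * w) ∧ |D₀.maninConstant| = 1) ∧
      ∀ (W : WeierstrassCurve ℚ) [W.IsElliptic] [W.IsGloballyMinimal] (D : ModularParametrizationData W 15),
        (∀ z ∈ D.L.lattice, ∃ w ∈ periodLattice D.f, z = D.c * w) → |D.maninConstant| = 1 := by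
  refine ⟨?_, fun W _ _ D hopt ↦ LevelFifteen.abs_maninConstant_eq_one_fifteen W D hopt⟩
  obtain ⟨W₀, h₀, hmin, D₀, -, hopt⟩ := domain_inhabited_fifteen_of_modularity hnf
  haveI := h₀
  haveI := hmin
  exact ⟨W₀, h₀, hmin, D₀, hopt, LevelFifteen.abs_maninConstant_eq_one_fifteen W₀ D₀ hopt⟩

end Summit.BirchSwinnertonDyer.BirchSwinnertonDyer.Theorems.ManinLocalTwoThree.NonVacuityFourteenFifteen

end
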